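import Mathlib
import Summits.Ventures.PercRepro.TriangleCapHungK3

/-!
# PercRepro — THE SECOND-ORDER LOCUS OF THE ROW `a = 3` AT `r = 1`, THE STRICT CASES: the cap with every degree
`≥ 3`, the convexity, the cross-row deletion (p3, gen 45; part 200a′)

On the cell `(k, 3, 1)` the second-best value is `m k − (k − 2) − 2 (k − 7)` (part 190, the family `T`). The cases
of part 190's degree argument that cannot attain it, for `k ≥ 10`:
* `three_one_cap_strict` (every degree `≥ 3`): a vertex `x` of degree `k − 3` makes `D` `3`-bipartite or at least
  `2` more below than `T` — the count of part 198a with `|R| = 2`: `2P + E = 4K − 2 − 2M`, an edge `u v` inside `R`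
  would force `K ≤ 3 + M ≤ 3 + K/2`, so `E = 0` and `M ≤ 1`; at `M = 1` every `y ∈ N(x)` has degree `≤ 3` — a
  matched vertex `y` of degree `4` would have both `u, v`, leaving its partner `y′` with none and degree `2` — so
  `Σ_N d² ≤ 3 Σ_N d = 9K`, `Σ_R d² ≤ (K − 1) P = 2 (K − 1)²`, and `Σ d² ≤ 3K² + 5K + 2 = T-value − 2`.
* `three_one_convex_strict`: every degree in `[3, k − 4]` is `2 (k − 6) = T + 2` below (part 190's convexity).
* `three_one_cross_strict`: a vertex of degree `d ≤ 1` is deleted onto the cell `(k − 1, 4, k − 10 + d)`, strictly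
  below (the neighbours at `≤ k − 4`; room `6k − 54` at `d = 1`, `8k − 74` at `d = 0`).
Axioms: standard.
-/

namespace PercRepro

namespace TriangleCap

namespace C047

open Finset

variable {V : Type*} [Fintype V] [DecidableEq V]

/-- The count at the cap of the cell `(k, 3, 1)`, `k ≥ 10`: `2K + 2M + 2P + E = 2m`, `m + 1 = 3K`, `P + 2M ≤ 2K`,
`2M ≤ K`, `E ≤ 2`, and an edge inside `R` would force `P ≤ K + 1` ⇒ `E = 0` and `M ≤ 1`. -/
theorem three_one_cap_count (K M P E m : ℕ) (hdeg : K + (K + 2 * M + P) + (P + E) = 2 * m) (hm : m + 1 = 3 * K)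
    (h2 : P + 2 * M ≤ 2 * K) (hMK : 2 * M ≤ K) (hE : E ≤ 2) (hK : 7 ≤ K) (hnoedge : 1 ≤ E → P ≤ K + 1) :
    E = 0 ∧ M ≤ 1 := by
  by_cases hE1 : 1 ≤ E
  · have := hnoedge hE1
    omega
  · omega

/-- The arithmetic of the strict cap: `K ≥ 7`, `m + 1 = 3K`, `2K + 2 + 2P = 2m`, `S_N ≤ 9K`, `S_R ≤ (K − 1) P` ⇒
`K² + S_N + S_R + (k − 2) + 2 (k − 7) + 2 ≤ m k`, `k = K + 3`. -/
theorem three_one_cap_arith (K P SN SR m : ℕ) (hK : 7 ≤ K) (hm : m + 1 = 3 * K) (hP : 2 * K + 2 + 2 * P = 2 * m)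
    (hSN : SN ≤ 9 * K) (hSR : SR ≤ (K - 1) * P) :
    K * K + SN + SR + (K + 3 - 2) + 2 * (K + 3 - 7) + 2 ≤ m * (K + 3) := by
  obtain ⟨t, rfl⟩ : ∃ t, K = t + 7 := ⟨K - 7, by omega⟩
  have hP' : P = 2 * t + 12 := by omega
  have hm' : m = 3 * t + 20 := by omega
  subst hP' hm'
  have e1 : t + 7 + 3 - 2 = t + 8 := by omega
  have e2 : t + 7 + 3 - 7 = t + 3 := by omega
  have e3 : t + 7 - 1 = t + 6 := by omega
  rw [e1, e2]
  rw [e3] at hSR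
  nlinarith [hSN, hSR]

/-- **THE CAP ON THE CELL `(k, 3, 1)` WITH EVERY DEGREE `≥ 3`, `k ≥ 10`, IS STRICT:** a vertex `x` of degree `k − 3`
makes `D` `3`-bipartite or `Σ_v d(v)² + (k − 2) + 2 (k − 7) + 2 ≤ m k`. -/
theorem three_one_cap_strict (D : SimpleGraph V) [DecidableRel D.Adj] (hK : K4mFree D)
    (hk : 10 ≤ Fintype.card V) (hm : D.edgeFinset.card + 1 = 3 * (Fintype.card V - 3))
    (hdeg3 : ∀ v, 3 ≤ deg D v) (x : V) (hx : deg D x + 3 = Fintype.card V) :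
    (∃ A : Finset V, A.card = 3 ∧ BipSub D A) ∨
      ∑ v, deg D v * deg D v + (Fintype.card V - 2) + 2 * (Fintype.card V - 7) + 2 ≤
        D.edgeFinset.card * Fintype.card V := by
  obtain ⟨N, hN⟩ : ∃ N : Finset V, N = univ.filter (fun w => D.Adj x w) := ⟨_, rfl⟩
  have hmemN : ∀ w, w ∈ N ↔ D.Adj x w := fun w => by rw [hN, mem_filter]; simp only [mem_univ, true_and]
  have hxN : x ∉ N := fun h => D.irrefl ((hmemN x).mp h)
  have hdx : deg D x = N.card := by rw [hN]; rfl
  obtain ⟨K, hKdef⟩ : ∃ K, N.card = K := ⟨_, rfl⟩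
  have hcardV : Fintype.card V = K + 3 := by omega
  obtain ⟨m, hmdef⟩ : ∃ m, D.edgeFinset.card = m := ⟨_, rfl⟩
  rw [hmdef, hcardV, Nat.add_sub_cancel] at hm
  -- the non-neighbours `R`, `|R| = 2`
  obtain ⟨R, hR⟩ : ∃ R : Finset V, R = (insert x N)ᶜ := ⟨_, rfl⟩
  have hRcard : R.card = 2 := by
    rw [hR, card_compl, card_insert_of_notMem hxN]
    omega
  have hmemR : ∀ w, w ∈ R ↔ w ≠ x ∧ ¬ D.Adj x w := by
    intro w
    rw [hR, mem_compl, mem_insert, hmemN]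
    tauto
  -- the matching inside `N`
  obtain ⟨M, hM⟩ : ∃ M, adjPairs D N = 2 * M := ⟨_, adjPairs_eq_two_mul D N⟩
  have hTf : ∑ y ∈ N, degIn D N y = 2 * M := by rw [← adjPairs_eq_sum_degIn, hM]
  have hfle : ∀ y ∈ N, degIn D N y ≤ 1 := by
    intro y hy
    have h1 := degIn_nbhd_le_one D hK (x := x) (u := y) ((hmemN y).mp hy)
    rw [← hN] at h1
    exact h1
  have hMK : 2 * M ≤ K := by
    have : ∑ y ∈ N, degIn D N y ≤ ∑ _y ∈ N, 1 := sum_le_sum hfle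
    rw [hTf, sum_const, smul_eq_mul, mul_one, hKdef] at this
    exact this
  obtain ⟨P, hPdef⟩ : ∃ P, ∑ u ∈ R, degIn D N u = P := ⟨_, rfl⟩
  obtain ⟨E, hEdef⟩ : ∃ E, adjPairs D R = E := ⟨_, rfl⟩
  have hsplit : ∀ F : V → ℕ, ∑ w, F w = F x + ∑ y ∈ N, F y + ∑ u ∈ R, F u := by
    intro F
    rw [← sum_add_sum_compl (insert x N), sum_insert hxN, ← hR]
  have hdegN : ∀ y ∈ N, deg D y = 1 + degIn D N y + degIn D R y := by
    intro y hy
    have := deg_eq_of_mem_nbhd D x y ((hmemN y).mp hy)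
    rw [← hN, ← hR] at this
    exact this
  have hsumN : ∑ y ∈ N, deg D y = K + 2 * M + P := by
    rw [sum_congr rfl hdegN, sum_add_distrib, sum_add_distrib, sum_const, smul_eq_mul, mul_one, hKdef, hTf,
      sum_degIn_comm D N R, hPdef]
  have hdegR : ∀ u ∈ R, deg D u = degIn D N u + degIn D R u := by
    intro u hu
    have := deg_eq_of_not_mem_nbhd D x u ((hmemR u).mp hu).2
    rw [← hN, ← hR] at this
    exact this
  have hsumR : ∑ u ∈ R, deg D u = P + E := by
    rw [sum_congr rfl hdegR, sum_add_distrib, hPdef, ← adjPairs_eq_sum_degIn, hEdef]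
  have hdegsum := sum_deg_eq D
  rw [hsplit, hsumN, hsumR, hdx, hKdef, hmdef] at hdegsum
  have hPle : ∀ u ∈ R, degIn D N u + M ≤ K := by
    intro u hu
    have := two_mul_degIn_add_adjPairs_le D hK (x := x) ((hmemR u).mp hu).1
    rw [← hN, hM, hKdef] at this
    omega
  have h2 : P + 2 * M ≤ 2 * K := by
    have hs : ∑ u ∈ R, (degIn D N u + M) ≤ ∑ _u ∈ R, K := sum_le_sum hPle
    rw [sum_add_distrib, sum_const, sum_const, smul_eq_mul, smul_eq_mul, hPdef, hRcard] at hs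
    exact hs
  have hE2 : E ≤ 2 := by
    have := adjPairs_le_card_mul_pred D R
    rw [hEdef, hRcard] at this
    exact this
  -- an edge inside `R` forces `P ≤ K + 1`
  have hnoedge : 1 ≤ E → P ≤ K + 1 := by
    intro hE
    obtain ⟨u, hu, hu1⟩ : ∃ u ∈ R, 1 ≤ degIn D R u := by
      by_contra hcon
      push Not at hcon
      have h0 : ∑ u ∈ R, degIn D R u = 0 := sum_eq_zero (fun u hu => by have := hcon u hu; omega)
      rw [← adjPairs_eq_sum_degIn, hEdef] at h0
      omega
    obtain ⟨v, hv, huv⟩ : ∃ v ∈ R, D.Adj u v := by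
      unfold degIn at hu1
      obtain ⟨v, hv⟩ := card_pos.mp hu1
      rw [mem_filter] at hv
      exact ⟨v, hv.1, hv.2⟩
    have hne : u ≠ v := D.ne_of_adj huv
    have hPuv : degIn D N u + degIn D N v ≤ K + 1 := by
      have := degIn_add_degIn_le_of_adj_pair D hK N huv
      rw [hKdef] at this
      exact this
    have hRuv : R = {u, v} := by
      symm
      apply eq_of_subset_of_card_le
      · intro w hw
        rw [mem_insert, mem_singleton] at hw
        rcases hw with rfl | rfl
        · exact hu
        · exact hv
      · rw [hRcard, card_pair hne]
    rw [hRuv, sum_pair hne] at hPdef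
    omega
  obtain ⟨hE0, hM1⟩ := three_one_cap_count K M P E m hdegsum hm h2 hMK hE2 (by omega) hnoedge
  have hnoR : ∀ u ∈ R, degIn D R u = 0 := by
    intro u hu
    have hle : degIn D R u ≤ ∑ z ∈ R, degIn D R z := single_le_sum (fun _ _ => Nat.zero_le _) hu
    rw [← adjPairs_eq_sum_degIn, hEdef, hE0] at hle
    exact Nat.le_zero.mp hle
  rcases Nat.eq_zero_or_pos M with hM0 | hMpos
  · -- `M = 0`: `D ⊆ K(Nᶜ, N)`
    left
    have hnoN : ∀ y ∈ N, ∀ y', D.Adj y y' → y' ∉ N := by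
      intro y hy y' hyy' hy'
      have h0 : degIn D N y = 0 := by
        have hle : degIn D N y ≤ ∑ z ∈ N, degIn D N z := single_le_sum (fun _ _ => Nat.zero_le _) hy
        rw [hTf, hM0, mul_zero] at hle
        exact Nat.le_zero.mp hle
      unfold degIn at h0
      rw [card_eq_zero, filter_eq_empty_iff] at h0
      exact h0 hy' hyy'
    have hnoR' : ∀ u ∈ R, ∀ u', D.Adj u u' → u' ∉ R := by
      intro u hu u' huu' hu'
      have h0 := hnoR u hu
      unfold degIn at h0
      rw [card_eq_zero, filter_eq_empty_iff] at h0
      exact h0 hu' huu'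
    refine ⟨Nᶜ, ?_, ?_⟩
    · rw [card_compl, hKdef]
      omega
    · intro p q hpq
      rw [mem_compl, mem_compl, not_not]
      constructor
      · intro hpN
        by_contra hqN
        by_cases hpx : p = x
        · subst hpx
          exact hqN ((hmemN q).mpr hpq)
        by_cases hqx : q = x
        · subst hqx
          exact hpN ((hmemN p).mpr (D.adj_symm hpq))
        have hpR : p ∈ R := (hmemR p).mpr ⟨hpx, fun h => hpN ((hmemN p).mpr h)⟩
        have hqR : q ∈ R := (hmemR q).mpr ⟨hqx, fun h => hqN ((hmemN q).mpr h)⟩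
        exact hnoR' p hpR q hpq hqR
      · intro hqN hpN
        exact hnoN p hpN q hpq hqN
  · -- `M = 1`: every `y ∈ N` has degree `≤ 3`
    right
    have hM1' : M = 1 := by omega
    subst hM1'
    have hSR : ∑ u ∈ R, deg D u * deg D u ≤ (K - 1) * P := by
      have h : ∀ u ∈ R, deg D u * deg D u ≤ (K - 1) * degIn D N u := by
        intro u hu
        have e : deg D u = degIn D N u := by rw [hdegR u hu, hnoR u hu, add_zero]
        have hle : degIn D N u ≤ K - 1 := by have := hPle u hu; omega
        rw [e]
        exact Nat.mul_le_mul_right _ hle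
      calc ∑ u ∈ R, deg D u * deg D u ≤ ∑ u ∈ R, (K - 1) * degIn D N u := sum_le_sum h
        _ = (K - 1) * P := by rw [← mul_sum, hPdef]
    -- every vertex of `N` has degree `≤ 3`
    have hdegN3 : ∀ y ∈ N, deg D y ≤ 3 := by
      intro y hy
      have hgle : degIn D R y ≤ 2 := by
        have := degIn_le_card D R y
        rw [hRcard] at this
        exact this
      rcases Nat.eq_zero_or_pos (degIn D N y) with hf0 | hfpos
      · rw [hdegN y hy, hf0]
        omega
      · -- `y` is matched to `y'`; `g(y) + g(y') ≤ 2` and `d(y') ≥ 3` force `g(y) ≤ 1`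
        obtain ⟨y', hy'N, hyy'⟩ : ∃ y' ∈ N, D.Adj y y' := by
          unfold degIn at hfpos
          obtain ⟨y', hy'⟩ := card_pos.mp hfpos
          rw [mem_filter] at hy'
          exact ⟨y', hy'.1, hy'.2⟩
        have hpair := degIn_add_degIn_le_card_of_nbhd_edge D hK x R (fun u hu => ((hmemR u).mp hu).1)
          ((hmemN y).mp hy) ((hmemN y').mp hy'N) hyy'
        rw [hRcard] at hpair
        have h3 := hdeg3 y'
        rw [hdegN y' hy'N] at h3
        have hf' := hfle y' hy'N
        have hf := hfle y hy
        rw [hdegN y hy]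
        omega
    have hSN : ∑ y ∈ N, deg D y * deg D y ≤ 9 * K := by
      calc ∑ y ∈ N, deg D y * deg D y ≤ ∑ y ∈ N, 3 * deg D y :=
            sum_le_sum (fun y hy => Nat.mul_le_mul_right _ (hdegN3 y hy))
        _ = 3 * (K + 2 * 1 + P) := by rw [← mul_sum, hsumN]
        _ ≤ 9 * K := by
          rw [hE0] at hdegsum
          omega
    rw [hsplit (fun v => deg D v * deg D v), hdx, hKdef, hmdef, hcardV]
    rw [hE0] at hdegsum
    exact three_one_cap_arith K P _ _ m (by omega) hm (by omega) hSN hSR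

omit [DecidableEq V] in
/-- **EVERY DEGREE IN `[3, k − 4]` ON THE CELL `(k, 3, 1)` IS STRICT:** `Σ_v d(v)² + (k − 2) + 2 (k − 7) + 2 ≤ m k`
(`k ≥ 7`). -/
theorem three_one_convex_strict (D : SimpleGraph V) [DecidableRel D.Adj] (hk : 7 ≤ Fintype.card V)
    (hm : D.edgeFinset.card + 1 = 3 * (Fintype.card V - 3)) (hcap : ∀ v, deg D v + 4 ≤ Fintype.card V)
    (hdeg : ∀ v, 3 ≤ deg D v) :
    ∑ v, deg D v * deg D v + (Fintype.card V - 2) + 2 * (Fintype.card V - 7) + 2 ≤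
      D.edgeFinset.card * Fintype.card V := by
  have h := three_row_convex D 1 (by omega) (by omega) hcap hdeg
  have e : Fintype.card V - 1 - 1 = Fintype.card V - 2 := by omega
  rw [e, one_mul] at h
  omega

/-- The arithmetic of the cross-row deletion on `(k, 3, 1)`, `k ≥ 10`, `d ≤ 1`: `D − z` on the cell
`(k − 1, 4, k − 10 + d)`. -/
theorem three_one_cross_arith (k m m' S' T d : ℕ) (hk : 10 ≤ k) (hd : d ≤ 1) (hm : m + 1 = 3 * (k - 3))
    (hm' : m' + d = m) (hS' : S' + (k - 10 + d) * (k - 1 - 1 - (k - 10 + d)) ≤ m' * (k - 1))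
    (hT : T ≤ d * (k - 4)) :
    S' + 2 * T + d + d * d + (k - 2) + 2 * (k - 7) + 2 ≤ m * k := by
  obtain ⟨t, rfl⟩ : ∃ t, k = t + 10 := ⟨k - 10, by omega⟩
  have hm1 : m = 3 * t + 20 := by omega
  subst hm1
  interval_cases d
  · have hm2 : m' = 3 * t + 20 := by omega
    subst hm2
    have e1 : t + 10 - 10 + 0 = t := by omega
    have e2 : t + 10 - 1 - 1 - t = 8 := by omega
    have e3 : t + 10 - 1 = t + 9 := by omega
    have e4 : t + 10 - 2 = t + 8 := by omega
    have e5 : t + 10 - 7 = t + 3 := by omega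
    rw [e1, e2, e3] at hS'
    rw [e4, e5]
    nlinarith [hS', hT]
  · have hm2 : m' = 3 * t + 19 := by omega
    subst hm2
    have e1 : t + 10 - 10 + 1 = t + 1 := by omega
    have e2 : t + 10 - 1 - 1 - (t + 1) = 7 := by omega
    have e3 : t + 10 - 1 = t + 9 := by omega
    have e4 : t + 10 - 2 = t + 8 := by omega
    have e5 : t + 10 - 7 = t + 3 := by omega
    have e6 : t + 10 - 4 = t + 6 := by omega
    rw [e1, e2, e3] at hS'
    rw [e6] at hT
    rw [e4, e5]
    nlinarith [hS', hT]

/-- **A VERTEX OF DEGREE `≤ 1` ON THE CELL `(k, 3, 1)`, `k ≥ 10`, IS STRICTLY BELOW:** the cross-row deletion onto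
the cell `(k − 1, 4, k − 10 + d)` of the closed form (the neighbours at `≤ k − 4` in `D − z`). -/
theorem three_one_cross_strict (D : SimpleGraph V) [DecidableRel D.Adj] (hK : K4mFree D)
    (hk : 10 ≤ Fintype.card V) (hm : D.edgeFinset.card + 1 = 3 * (Fintype.card V - 3))
    (hcap : ∀ v, deg D v + 3 ≤ Fintype.card V) (z : V) (hz : deg D z ≤ 1) :
    ∑ v, deg D v * deg D v + (Fintype.card V - 2) + 2 * (Fintype.card V - 7) + 2 ≤
      D.edgeFinset.card * Fintype.card V := by
  have hK' := k4mFree_del D hK z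
  have hcard' := card_del z
  have hedges' := card_edges_del D z
  have hsq := sum_deg_sq_del D z
  have hT := sum_del_nbhd_le D z (Fintype.card V - 4) (fun v => by have := hcap v; omega)
  obtain ⟨k, hk'⟩ : ∃ k, Fintype.card V = k := ⟨_, rfl⟩
  have hcardW' : Fintype.card {v : V // v ≠ z} = k - 1 := by omega
  obtain ⟨d, hd⟩ : ∃ d, deg D z = d := ⟨_, rfl⟩
  rw [hd] at hz hedges' hsq hT
  obtain ⟨m, hmdef⟩ : ∃ m, D.edgeFinset.card = m := ⟨_, rfl⟩
  obtain ⟨m', hm'def⟩ : ∃ m', (del D z).edgeFinset.card = m' := ⟨_, rfl⟩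
  rw [hmdef] at hedges' hm
  rw [hm'def] at hedges'
  rw [hk'] at hm hk hT
  have hm'' : (del D z).edgeFinset.card + 4 * 4 + (k - 10 + d) = 4 * Fintype.card {v : V // v ≠ z} := by
    rw [hm'def, hcardW']
    omega
  have hS' := closed_form_stability (del D z) hK' 4 (k - 10 + d) (by norm_num) (by rw [hcardW']; omega) hm''
  obtain ⟨T, hTdef⟩ : ∃ T, ∑ w : {v : V // v ≠ z}, (if D.Adj w.1 z then deg (del D z) w else 0) = T := ⟨_, rfl⟩
  obtain ⟨S', hS'def⟩ : ∃ S', ∑ w : {v : V // v ≠ z}, deg (del D z) w * deg (del D z) w = S' := ⟨_, rfl⟩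
  rw [hTdef, hS'def] at hsq
  rw [hTdef] at hT
  rw [hS'def, hm'def, hcardW'] at hS'
  rw [hsq, hmdef, hk']
  exact three_one_cross_arith k m m' S' T d hk hz hm hedges' hS' hT

end C047

end TriangleCap

end PercRepro
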